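import Literature.AlgebraicGeometry.Motives.CartierDivisorCechAffine
import Literature.Algebra.Homology.OrderedCechLinkExact
import Mathlib.AlgebraicGeometry.Morphisms.Separated
import HarnessLib

/-!
# The links of the Čech complex of `𝒪_X(D)` for a family of affine opens over an affine base are
# exact (Görtz–Wedhorn II, Lemma 22.1 ⟹ Thm. 22.9)

Let `pr : Y → B` be separated with `Y` integral, `V ⊆ B` an affine open, `D` a Cartier divisor on
`Y` and `W_a` (`a ∈ ι`, finite, linearly ordered) affine non-empty opens of `pr⁻¹V`, each inside a
chart of `D`; let `F s = Γ(pr⁻¹V ∩ ⋂_{a ∈ s} W_a, 𝒪_Y(D)) ⊆ K(Y)` be the associated monotone family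
of modules over a base ring `A` acting on `K(Y)` by functions regular on `pr⁻¹V` (this is the shape
of `CartierDivisor.CechCover.sectionsOn`, `Motives/CartierDivisorCech`, for any indexing of the
members, e.g. the disjoint union of two Čech covers). This file PROVES:

* `CartierDivisor.isAffineOpen_preimage_inf_finsetInf` — the `W_s = pr⁻¹V ∩ ⋂_{a ∈ s} W_a`,
  `s ≠ ∅`, are affine (`pr` has affine diagonal; Görtz–Wedhorn II, proof of Thm. 22.9);
* `CartierDivisor.linkExact_sectionsOn` — **for every non-empty `t` and every `J` disjoint from
  `t` such that the `W_j`, `j ∈ J`, cover `pr⁻¹V`, the link of `t` over `J` is exact**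
  (`OrderedCech.LinkExact F J t`, the hypothesis of `OrderedCech.quasiIso_restrictMap` of
  `Literature/Algebra/Homology/OrderedCechRestrict`): the link family `s' ↦ F (t ∪ s')` is the
  family `CartierDivisor.cechFamily D W_t (W_j)_{j ∈ J}` of `Motives/CartierDivisorCechAffine` on
  the affine `W_t`, whose ordered Čech complex is acyclic with `Ȟ⁰ = Γ(W_t, 𝒪(D))`
  (`exactAt_complex_cechFamily`, `iInf_cechFamily_singleton_eq` — Görtz–Wedhorn II, Lemma 22.1
  for `𝒪(D)|_{W_t}`), and `OrderedCech.linkExact_of_exactAt`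
  (`Literature/Algebra/Homology/OrderedCechLinkExact`) translates.

So the restriction of `Č•(F)` to any sub-family of the `W_a` that still covers `pr⁻¹V` is a
quasi-isomorphism (`OrderedCech.quasiIso_restrictMap`), which is the comparison of the Čech
complexes of `𝒪_Y(D)` for two Čech covers through their disjoint union (Görtz–Wedhorn II,
Thm. 22.9, for `𝒪(D)`). No named facts are introduced. Mathlib searched (pin):
`isAffineHom_diagonal_iff`, `Finset.inf_union`, `Finset.inf_map` (used).

## References

* U. Görtz, T. Wedhorn, *Algebraic Geometry II: Cohomology of Schemes*, Springer Spektrum (2023),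
  doi:10.1007/978-3-658-43031-3: Lemma 22.1, p. 327; Thm. 22.9 and its proof, Rem. 22.12,
  pp. 332–333 (read via the held copy). [GortzWedhorn2023]
-/

universe u

open CategoryTheory CategoryTheory.Limits AlgebraicGeometry TopologicalSpace Opposite
open Literature.Algebra.Homology Literature.Algebra.Homology.OrderedCech

noncomputable section

namespace Literature.AlgebraicGeometry.Motives

open RatFn

namespace CartierDivisor

variable {Y B : Scheme.{u}} (pr : Y ⟶ B) (V : B.Opens)

/-! ### Intersections of affine opens over an affine base are affine -/

/-- **The intersections `pr⁻¹V ∩ ⋂_{a ∈ s} W_a` (`s ≠ ∅`) of affine opens `W_a ⊆ pr⁻¹V` are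
affine** when `V` is affine and `pr` is separated (`pr` has affine diagonal, Mathlib
`isAffineHom_diagonal_iff`; Görtz–Wedhorn II, proof of Thm. 22.9 / Rem. 22.12).
[cite: GortzWedhorn2023, Thm. 22.9, proof (p. 332)] -/
theorem isAffineOpen_preimage_inf_finsetInf [IsSeparated pr] (hV : IsAffineOpen V) {ι : Type}
    {W : ι → Y.Opens} (hWV : ∀ a, W a ≤ pr ⁻¹ᵁ V) (haff : ∀ a, IsAffineOpen (W a))
    {s : Finset ι} (hs : s.Nonempty) : IsAffineOpen (pr ⁻¹ᵁ V ⊓ s.inf W) := by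
  classical
  have key := isAffineHom_diagonal_iff.mp (inferInstance : IsAffineHom (pullback.diagonal pr)) V hV
  induction s using Finset.induction_on with
  | empty => exact absurd hs Finset.not_nonempty_empty
  | insert a s has ih =>
    by_cases hs' : s.Nonempty
    · have e : pr ⁻¹ᵁ V ⊓ (insert a s).inf W = W a ⊓ (pr ⁻¹ᵁ V ⊓ s.inf W) := by
        rw [Finset.inf_insert]
        ext1
        simp only [Opens.coe_inf]
        rw [Set.inter_left_comm]
      rw [e]
      exact key _ (hWV a) _ inf_le_left (haff a) (ih hs')
    · rw [Finset.not_nonempty_iff_eq_empty] at hs'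
      subst hs'
      have e : pr ⁻¹ᵁ V ⊓ (insert a ∅ : Finset ι).inf W = W a := by
        rw [Finset.insert_empty, Finset.inf_singleton]
        exact inf_eq_right.2 (hWV a)
      rw [e]
      exact haff a

/-! ### Exactness of the links for `𝒪_Y(D)` -/

variable [IsIntegral Y] (D : CartierDivisor Y) {ι : Type} [LinearOrder ι] (W : ι → Y.Opens)
  {A : Type u} [CommRing A] [Algebra A Y.functionField]

/-- `sectionsOn` only depends on the open. [folklore] -/
theorem sectionsOn_congr {O₁ O₂ : Y.Opens} (h : O₁ = O₂)
    (h₁ : ∀ a, ∀ x ∈ O₁, IsRegularAt x (algebraMap A Y.functionField a))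
    (h₂ : ∀ a, ∀ x ∈ O₂, IsRegularAt x (algebraMap A Y.functionField a)) :
    D.sectionsOn O₁ h₁ = D.sectionsOn O₂ h₂ := by
  subst h
  rfl

/-- **The links of the family `s ↦ Γ(pr⁻¹V ∩ ⋂_{a ∈ s} W_a, 𝒪_Y(D))` are exact** (Görtz–Wedhorn II,
Lemma 22.1 ⟹ Thm. 22.9 for `𝒪(D)`): for `pr` separated, `V` affine, `W_a ⊆ pr⁻¹V` affine
non-empty inside charts of `D`, `A` acting by functions regular on `pr⁻¹V`, every non-empty `t`
and every `J` disjoint from `t` whose members cover `pr⁻¹V` give `OrderedCech.LinkExact F J t` — the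
link family `s' ↦ F (t ∪ s')` being the Čech family of `𝒪(D)|_{W_t}` for the cover
`(W_t ∩ W_j)_{j ∈ J}` of the affine `W_t` (`Motives/CartierDivisorCechAffine`), translated by
`OrderedCech.linkExact_of_exactAt`. The family `F` is taken with an explicit description `hF` so
that the statement applies verbatim to `CartierDivisor.CechCover.sectionsOn` of any cover.
[cite: GortzWedhorn2023, Lemma 22.1 (p. 327) and Thm. 22.9 (p. 332)] -/
theorem linkExact_sectionsOn [IsSeparated pr] (hV : IsAffineOpen V)
    (hWV : ∀ a, W a ≤ pr ⁻¹ᵁ V) (haff : ∀ a, IsAffineOpen (W a))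
    (hξW : ∀ a, genericPoint Y ∈ W a) (chart : ι → D.ι) (hWchart : ∀ a, W a ≤ D.U (chart a))
    (hρ : ∀ a, ∀ x ∈ pr ⁻¹ᵁ V, IsRegularAt x (algebraMap A Y.functionField a))
    (F : Finset ι → Submodule A Y.functionField)
    (hF : ∀ s, F s = D.sectionsOn (pr ⁻¹ᵁ V ⊓ s.inf W) fun a x hx => hρ a x hx.1)
    {J t : Finset ι} (hJcov : pr ⁻¹ᵁ V ≤ ⨆ j : ↥J, W j) (ht : t.Nonempty) (htJ : Disjoint t J) :
    LinkExact (A := A) F J t := by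
  classical
  have hFmono : Monotone F := by
    intro s s' h
    rw [hF s, hF s']
    exact sectionsOn_mono (inf_le_inf_left _ (Finset.inf_mono h)) _ _
  obtain ⟨a₀, ha₀⟩ := ht
  -- `J` is non-empty: its members cover the non-empty `pr⁻¹V`
  have hJ : J.Nonempty := by
    obtain ⟨j, -⟩ := Opens.mem_iSup.1 (hJcov (hWV a₀ (hξW a₀)))
    exact ⟨j, j.2⟩
  -- the affine piece `U = W_t`
  set U : Y.Opens := pr ⁻¹ᵁ V ⊓ t.inf W with hU
  have hUaff : IsAffineOpen U := isAffineOpen_preimage_inf_finsetInf pr V hV hWV haff ⟨a₀, ha₀⟩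
  have hUV : U ≤ pr ⁻¹ᵁ V := inf_le_left
  have hξU : genericPoint Y ∈ U := by
    refine ⟨hWV a₀ (hξW a₀), ?_⟩
    have : ∀ s : Finset ι, genericPoint Y ∈ s.inf W := fun s => by
      induction s using Finset.induction_on with
      | empty => simp
      | insert a s _ ih => rw [Finset.inf_insert]; exact ⟨hξW a, ih⟩
    exact this t
  have hρU : ∀ a, ∀ x ∈ U, IsRegularAt x (algebraMap A Y.functionField a) :=
    fun a x hx => hρ a x (hUV hx)
  -- the link family is the Čech family of `𝒪(D)|_U` for the cover `(W_j)_{j ∈ J}`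
  have hopens : ∀ s' : Finset ↥J,
      pr ⁻¹ᵁ V ⊓ (t ∪ s'.map (Function.Embedding.subtype (· ∈ J))).inf W =
        cechOpens U (fun j : ↥J => W j) s' := by
    intro s'
    rw [cechOpens, hU, Finset.inf_union, Finset.inf_map, inf_assoc]
    rfl
  have hfam : linkFamily F J t = D.cechFamily U (fun j : ↥J => W j) hρU := by
    funext s'
    rw [linkFamily_apply, hF, cechFamily]
    exact sectionsOn_congr D (hopens s') _ _
  refine linkExact_of_exactAt hFmono hJ htJ (fun x hx => ?_) (fun m hm => ?_)
  · -- `Ȟ⁰`: `⋂_j Γ(U ∩ W_j, 𝒪(D)) = Γ(U, 𝒪(D))`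
    have hcov : U ≤ ⨆ j : ↥J, W j := hUV.trans hJcov
    have key := iInf_cechFamily_singleton_eq (D := D) (U := U) (W := fun j : ↥J => W j) hρU hcov
    have hxU : x ∈ D.sectionsOn U hρU := by
      rw [← key, Submodule.mem_iInf]
      intro j
      have hxj := hx j j.2
      rw [hF] at hxj
      have e : pr ⁻¹ᵁ V ⊓ (t ∪ {(j : ι)}).inf W = cechOpens U (fun j : ↥J => W j) {j} := by
        rw [← hopens {j}, Finset.map_singleton]
        rfl
      rw [cechFamily, ← sectionsOn_congr D e (fun a x hx => hρ a x hx.1)]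
      exact hxj
    rw [hF]
    have e : pr ⁻¹ᵁ V ⊓ t.inf W = U := hU.symm
    rwa [sectionsOn_congr D e _ hρU]
  · -- acyclicity on the affine `U`
    rw [complex_congr (linkFamily_mono J t hFmono)
      (cechFamily_mono D U (fun j : ↥J => W j) hρU) hfam]
    exact exactAt_complex_cechFamily D U (fun j : ↥J => W j) hUaff hξU hρU (fun j => chart j)
      (fun j => hWchart j) (fun j => hξW j) (hUV.trans hJcov)
      (fun s' hs' => by
        rw [← hopens s']
        exact isAffineOpen_preimage_inf_finsetInf pr V hV hWV haff
          ⟨a₀, Finset.mem_union_left _ ha₀⟩) m hm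

end CartierDivisor

end Literature.AlgebraicGeometry.Motives

end
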